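import Summits.QuantumFields.YangMills.Theses.LocalInsertion
import HarnessLib

/-!
# Route `LocalInsertion` (planner ym-r3-idea-2 g7, LINE 16 «LocalInsertion»), assembly item (stmt-QuantumFields-23609) — BY NAME

`MinimiserStabilityRegPr → FluctuationComparisonRegPrIntL → LocalInsertionL → HistoryTailOfInsertionL → YM3TorusSU2`: the glue
`HistoryTailOfInsertionL` turns the local exponential-moment bound `LocalInsertionL` into `UnitScaleTilt.HistoryTailL`, and the deciding theorem of
route `UnitScaleTilt` combines it with the two R3 cruxes (19200, 20520) into the rung-R3 leaf.  Proof = the route's own deciding λ-term.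

Width seat ym-line-sfw-p2-w2 g23 (cell ym-idea-1, R3 family; free hands).  HONEST FRAMING: R3 (`YM3TorusSU2`) is a RECORD rung of LADDER-YM; the
crux `LocalInsertionL` (XL), the glue `HistoryTailOfInsertionL`, 19200 and 20520 are OPEN; this is plumbing of a draft route; no summit is proved
and the Yang–Mills mass gap is NOT proved.
-/

set_option autoImplicit false

namespace Summit.QuantumFields.YangMills.Theorems

/-- **`LocalInsertion.Assembly`** (item stmt-QuantumFields-23609) BY NAME: the four hypotheses compose to the leaf exactly as in the route's
deciding theorem — `UnitScaleTilt.closes h200 h201 (hG hI)`. [folklore] -/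
theorem localInsertion_assembly_proof :
    Summit.QuantumFields.YangMills.Theses.LocalInsertion.Assembly :=
  fun h200 h201 hI hG => Summit.QuantumFields.YangMills.Theses.UnitScaleTilt.closes h200 h201 (hG hI)

end Summit.QuantumFields.YangMills.Theorems
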